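import Mathlib
import Summits.Ventures.DiscreteObjects.Mahler.SubLehmerDegreeEighteen
import Summits.Ventures.DiscreteObjects.Mahler.CensusKernelDeg18Final

/-!
# Lehmer's conjecture for every integer polynomial of degree ≤ 19, in the kernel (venture `DiscreteObjects`, target L)

Cell `pub-namedobj`, seats `pub-namedobj-mahler-g14` (author) and `pub-namedobj-mahler-g15` (degree-18 census landed with auxiliary-function cuts). Framing: lottery ticket; floor = certified bounds/negative
ranges.

The degree-18 kernel census row `degreeCensus_eighteen` (23 cores; census search with Fejér–Riesz, resultant AND kernel-certified explicit-auxiliary-function cuts,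
`CensusKernelDeg18A … Final`) added to `SubLehmerDegreeEighteen`:
* `minimalMeasure_degree_eighteen` — an irreducible `P` of degree `18` with `M(P) > 1` has
  `M(P) ≥ M(mrwMinimalPoly 18)` (MRW Table 1, `D = 18`, now a theorem for all integer polynomials of that degree);
  `minimalMeasureByDegree_le_eighteen` — the instances `D ≤ 18` of the Literature named fact `MinimalMeasureByDegree`;
* `lehmer_le_of_irreducible_of_natDegree_le_nineteen`, `lehmer_le_of_natDegree_le_nineteen` — every `P ∈ ℤ[X]` of
  degree `≤ 19` with `M(P) > 1` has `M(P) ≥ M(ℓ)`;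
* `twenty_le_natDegree_of_subLehmer` — `1 < M(P) < M(ℓ)` forces `deg P ≥ 20`; rungs `N ≤ 19` of the cell's sub-Lehmer
  ladder and every `HeightCell h s d` with `d ≤ 19`, unconditionally;
* `kernelCensus_le_nineteen` — the census rows at `13/10` for every degree `1 … 19`.
CONTROL rows (published complete lists reach degree 44); kernel theorems with the standard axioms.
-/

namespace Summit.Ventures.DiscreteObjects.Mahler

open Polynomial Literature.NumberTheory.MahlerMeasure

/-- **Degree 18 (MRW Table 1, D = 18):** an irreducible `P` of degree `18` with `M(P) > 1` has `M(P) ≥ M(mrwMinimalPoly 18)`. -/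
theorem minimalMeasure_degree_eighteen {P : ℤ[X]} (hirr : Irreducible P) (hdeg : P.natDegree = 18)
    (h1 : 1 < intMahlerMeasure P) : intMahlerMeasure (mrwMinimalPoly 18) ≤ intMahlerMeasure P := by
  by_cases h : intMahlerMeasure P < 13 / 10
  · obtain ⟨l, hl, hform⟩ := degreeCensus_eighteen P hdeg hirr h1 h
    rw [intMahlerMeasure_of_census_form hform]
    exact coresDeg18_min l hl
  · push Not at h
    have h18 : intMahlerMeasure (mrwMinimalPoly 18) ≤ intMahlerMeasure (ofCoeffs c18_01) :=
      coresDeg18_min c18_01 (by simp [coresDeg18])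
    exact le_trans h18 (le_trans (le_of_lt (coresDeg18_measure_bounds c18_01 (by simp [coresDeg18])).2) h)

/-- An irreducible `P` of degree `18` with `M(P) > 1` has `M(P) > 1.1883 > M(ℓ)`. -/
theorem lehmer_lt_of_irreducible_degree_eighteen {P : ℤ[X]} (hirr : Irreducible P) (hdeg : P.natDegree = 18)
    (h1 : 1 < intMahlerMeasure P) : intMahlerMeasure lehmerPoly < intMahlerMeasure P := by
  have hL : intMahlerMeasure lehmerPoly < 11883 / 10 ^ 4 := lt_trans lehmer_measure_upper_bound (by norm_num)
  by_cases h : intMahlerMeasure P < 13 / 10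
  · obtain ⟨l, hl, hform⟩ := degreeCensus_eighteen P hdeg hirr h1 h
    rw [intMahlerMeasure_of_census_form hform]
    have hne : l ≠ c10_01 := by
      rintro rfl
      simp [coresDeg18, c10_01, c18_01, c18_02, c18_03, c18_04, c18_05, c18_06, c18_07, c18_08, c18_09, c18_10,
        c18_11, c18_12, c18_13, c18_14, c18_15, c18_16, c18_17, c18_18, c18_19, c18_20, c18_21, c18_22, c18_23] at hl
    exact lt_trans hL (census_le18_gap l (by simp [hl]) hne)
  · push Not at h
    exact lt_of_lt_of_le (lt_trans hL (by norm_num)) h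

/-- **Irreducible polynomials of degree `≤ 19` satisfy Lehmer's bound.** -/
theorem lehmer_le_of_irreducible_of_natDegree_le_nineteen {P : ℤ[X]} (hirr : Irreducible P)
    (hdeg : P.natDegree ≤ 19) (h1 : 1 < intMahlerMeasure P) :
    intMahlerMeasure lehmerPoly ≤ intMahlerMeasure P := by
  by_cases h13 : P.natDegree ≤ 17
  · exact lehmer_le_of_irreducible_of_natDegree_le_seventeen hirr h13 h1
  by_cases hB : 13 / 10 ≤ intMahlerMeasure P
  · exact le_trans (le_of_lt (lt_trans lehmer_measure_upper_bound (by norm_num))) hB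
  push Not at h13 hB
  have hθ : intMahlerMeasure P < smythTheta := lt_trans hB (lt_trans (by norm_num) smythTheta_gt)
  obtain ⟨-, ⟨j, hj⟩, -⟩ := reciprocal_of_measure_lt_smythTheta hirr h1 hθ
  have hd : P.natDegree = 18 := by omega
  exact le_of_lt (lehmer_lt_of_irreducible_degree_eighteen hirr hd h1)

/-- **Lehmer's conjecture holds for every integer polynomial of degree `≤ 19`:** `M(P) > 1 ⇒ M(P) ≥ M(ℓ)`. -/
theorem lehmer_le_of_natDegree_le_nineteen {p : ℤ[X]} (hdeg : p.natDegree ≤ 19) (h1 : 1 < intMahlerMeasure p) :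
    intMahlerMeasure lehmerPoly ≤ intMahlerMeasure p := by
  classical
  have hp : p ≠ 0 := by
    intro h
    rw [h] at h1
    unfold intMahlerMeasure at h1
    rw [Polynomial.map_zero, mahlerMeasure_zero] at h1
    linarith
  obtain ⟨u, hu⟩ := UniqueFactorizationMonoid.factors_prod hp
  obtain ⟨c, hc, hcu⟩ := Polynomial.isUnit_iff.mp u.isUnit
  set F := UniqueFactorizationMonoid.factors p with hF
  have hFirr : ∀ f ∈ F, Irreducible f := fun f hf => UniqueFactorizationMonoid.irreducible_of_factor f hf
  have hMu : intMahlerMeasure (↑u : ℤ[X]) = 1 := by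
    rw [← hcu, intMahlerMeasure_C]
    rcases Int.isUnit_iff.mp hc with h | h <;> simp [h]
  have hMp : intMahlerMeasure p = (F.map intMahlerMeasure).prod := by
    rw [← hu, intMahlerMeasure_mul, hMu, mul_one, intMahlerMeasure_multiset_prod]
  have hdvd : ∀ f ∈ F, f ∣ p := fun f hf => (Multiset.dvd_prod hf).trans ⟨↑u, hu.symm⟩
  have hge1 : ∀ x ∈ F.map intMahlerMeasure, 1 ≤ x := by
    intro x hx
    obtain ⟨f, hf, rfl⟩ := Multiset.mem_map.mp hx
    exact one_le_intMahlerMeasure (hFirr f hf).ne_zero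
  have hprod_ge : ∀ x ∈ F.map intMahlerMeasure, x ≤ (F.map intMahlerMeasure).prod := by
    intro x hx
    obtain ⟨T, hT⟩ := Multiset.exists_cons_of_mem hx
    rw [hT, Multiset.prod_cons]
    have hT1 : 1 ≤ T.prod :=
      Multiset.one_le_prod (fun y hy => hge1 y (by rw [hT]; exact Multiset.mem_cons_of_mem hy))
    have hx0 : 0 ≤ x := le_trans zero_le_one (hge1 x hx)
    nlinarith
  by_contra hlt
  push Not at hlt
  have hall : ∀ x ∈ F.map intMahlerMeasure, x = 1 := by
    intro x hx
    obtain ⟨f, hf, rfl⟩ := Multiset.mem_map.mp hx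
    by_contra hne
    have hgt : 1 < intMahlerMeasure f := lt_of_le_of_ne (hge1 _ hx) (Ne.symm hne)
    have hfdeg : f.natDegree ≤ 19 := (natDegree_le_of_dvd (hdvd f hf) hp).trans hdeg
    have h2 := lehmer_le_of_irreducible_of_natDegree_le_nineteen (hFirr f hf) hfdeg hgt
    have h3 := hprod_ge _ hx
    rw [← hMp] at h3
    linarith
  have : (F.map intMahlerMeasure).prod = 1 := Multiset.prod_eq_one hall
  rw [← hMp] at this
  linarith

/-- **A sub-Lehmer polynomial has degree at least `20`.** -/
theorem twenty_le_natDegree_of_subLehmer {P : ℤ[X]} (hP : SubLehmer P) : 20 ≤ P.natDegree := by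
  by_contra h
  push Not at h
  have := lehmer_le_of_natDegree_le_nineteen (p := P) (by omega) hP.1
  exact absurd hP.2 (not_lt.mpr this)

/-- Census rows in the engines' format, degrees `≤ 19`, below Lehmer's measure: nothing. -/
theorem heightBoundedCensus_subLehmer_of_le_nineteen {n h : ℕ} (hn : n ≤ 19) :
    HeightBoundedCensus n h (intMahlerMeasure lehmerPoly) [] := by
  refine ⟨fun p hdeg _ h1 h2 => ?_, fun l hl => by simp at hl⟩
  exfalso
  have := lehmer_le_of_natDegree_le_nineteen (p := p) (by omega) h1
  linarith

/-- **Rungs `N ≤ 19` of the sub-Lehmer ladder, unconditionally, at every height bound `h`.** -/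
theorem heightSubLehmerEmptyUpTo_of_le_nineteen (h : ℕ) {N : ℕ} (hN : N ≤ 19) : HeightSubLehmerEmptyUpTo h N := by
  intro P hdeg _ hP
  have := twenty_le_natDegree_of_subLehmer hP
  omega

/-- Height-1 rungs `N ≤ 19`, unconditionally. -/
theorem height1SubLehmerEmptyUpTo_of_le_nineteen {N : ℕ} (hN : N ≤ 19) : Height1SubLehmerEmptyUpTo N :=
  (heightSubLehmerEmptyUpTo_one_iff N).mp (heightSubLehmerEmptyUpTo_of_le_nineteen 1 hN)

/-- Every cell `HeightCell h s d` with core degree `d ≤ 19` holds unconditionally. -/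
theorem heightCell_of_le_nineteen (h : ℕ) (s : Multiset ℕ) {d : ℕ} (hd : d ≤ 19) : HeightCell h s d := by
  intro Q hdeg _ _ _ _ _ hQ
  have := twenty_le_natDegree_of_subLehmer hQ
  omega

/-- **`MinimalMeasureByDegree` for `D ≤ 18` (proved):** for every even `8 ≤ D ≤ 18`, an irreducible integer polynomial
of degree `D` with `M > 1` (primitive or not) has `M ≥ M(mrwMinimalPoly D)` — the `D = 8, …, 18` rows of MRW's
Theorem 1.1 / Table 1 in the Literature file's own terms. -/
theorem minimalMeasureByDegree_le_eighteen :
    ∀ D : ℕ, Even D → 8 ≤ D → D ≤ 18 →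
      ∀ P : ℤ[X], Irreducible P → P.natDegree = D → 1 < (P.map (Int.castRingHom ℂ)).mahlerMeasure →
        (∀ k : ℕ, 2 ≤ k → ∀ Q : ℤ[X], P ≠ expand ℤ k Q) →
          ((mrwMinimalPoly D).map (Int.castRingHom ℂ)).mahlerMeasure ≤ (P.map (Int.castRingHom ℂ)).mahlerMeasure := by
  intro D hD h8 h18 P hirr hdeg h1 hprim
  by_cases h16 : D ≤ 16
  · exact minimalMeasureByDegree_le_sixteen D hD h8 h16 P hirr hdeg h1 hprim
  · have hD18 : D = 18 := by
      obtain ⟨k, rfl⟩ := hD; omega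
    subst hD18
    exact minimalMeasure_degree_eighteen hirr hdeg h1

/-- **The kernel census of small Mahler measures, degrees `1 … 19`, bound `13/10`:** the only irreducible integer
polynomials of degree `n ∈ [1, 19]` with `1 < M < 1.3` are, up to `±x`, the listed cores of degrees `8` (one), `10` (seven),
`12` (five), `14` (eleven), `16` (sixteen) and `18` (twenty-three listed); every other degree `≤ 19` has none. -/
theorem kernelCensus_le_nineteen :
    DegreeCensus 8 (13 / 10) coresDeg8 ∧ DegreeCensus 10 (13 / 10) coresDeg10 ∧ DegreeCensus 12 (13 / 10) coresDeg12 ∧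
      DegreeCensus 14 (13 / 10) coresDeg14 ∧ DegreeCensus 16 (13 / 10) coresDeg16 ∧ DegreeCensus 18 (13 / 10) coresDeg18 ∧
      ∀ n : ℕ, 1 ≤ n → n ≤ 19 → n ≠ 8 → n ≠ 10 → n ≠ 12 → n ≠ 14 → n ≠ 16 → n ≠ 18 → DegreeCensus n (13 / 10) [] := by
  refine ⟨degreeCensus_eight, degreeCensus_ten, degreeCensus_twelve, degreeCensus_fourteen, degreeCensus_sixteen,
    degreeCensus_eighteen, ?_⟩
  intro n hn1 hn15 h8 h10 h12 h14 h16 h18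
  have hθ : (13 : ℝ) / 10 ≤ smythTheta := le_of_lt (lt_trans (by norm_num) smythTheta_gt)
  rcases Nat.even_or_odd n with he | ho
  · have hφ : (13 : ℝ) / 10 ≤ (1 + Real.sqrt 5) / 2 := by
      have : (2 : ℝ) < Real.sqrt 5 := by
        rw [show (2 : ℝ) = Real.sqrt (2 ^ 2) by rw [Real.sqrt_sq (by norm_num)]]
        exact Real.sqrt_lt_sqrt (by norm_num) (by norm_num)
      linarith
    obtain ⟨k, rfl⟩ := he
    rcases (by omega : k = 1 ∨ k = 2 ∨ k = 3) with rfl | rfl | rfl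
    · exact degreeCensus_two_empty hφ
    · exact degreeCensus_mono (by norm_num) degreeCensus_four
    · exact degreeCensus_six
  · exact degreeCensus_odd_smythTheta ho hθ

end Summit.Ventures.DiscreteObjects.Mahler
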